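import Summits.FinalStateConjecture.FinalStateConjecture.Theorems.NearExtremalKappaCapture.Negative.ExponentMonotonicity
import Literature.Geometry.Lorentzian.HorizonPenetratingTeukolsky

/-!
# `NearExtremalKappaCapture`, line `polynomial-closure`: the shape of the transfer stub on the crux's own range

Crux `PhaseMixingCapture.NearExtremalKappaCapture` (stmt-FinalStateConjecture-10606), line `polynomial-closure`
(skeleton `Cruxes/NearExtremalKappaCapture/Lines/polynomial_closure.lean` rev 3). Its transfer stub
`stub_polynomialClosingBox` asserts, for EVERY sub-extremal spin `|a| < M` and all `Λ, B ≥ 1`: the spin-±2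
Teukolsky slab law with constant `Λ` on the parameter box and the background bound `B` give capture at `(M, a)`
with basin `c₀ χ^{γ₀} ((ΛB)^N)⁻¹` and modulus `C₀ χ^{−γ₀} (ΛB)^N` (`χ = 1 − (a/M)²`).

This file records, kernel-checked, that ON THE NEAR-EXTREMAL RANGE `a₁M ≤ |a| < M` the transfer stub is a
CONSEQUENCE OF THE CRUX ITSELF with both analytic hypotheses (slab law, background bound) UNUSED and with
`N = 0` (no `Λ`, `B` bookkeeping at all): `closingBoxNearExtremal_of_near`. Hence on that range the stub carries
no information beyond the crux, and the line's leverage over the crux lies entirely in (i) the κ-polynomial slab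
law `C⁺` (open; the sibling crux stmt-FinalStateConjecture-10654 at spin ±2) and (ii) the slowly-rotating range
`|a| < a₁M` of the transfer (fixed-spin tracked nonlinear stability, not in the tree). Companion of
`Theorems/PhaseMixingCaptureNearExtremalKappaCaptureTransferShape.lean` (the same observation for line
`unit-temperature-front-face`). Lead prover-line-stmt-FinalStateConjecture-10606-a1-0, 2026-08-16.
-/

noncomputable section

set_option linter.dupNamespace false

namespace Summit.FinalStateConjecture.FinalStateConjecture.Theorems.NearExtremalKappaCapture.PolynomialClosure

open Literature.Geometry.Lorentzian
open Summit.FinalStateConjecture.FinalStateConjecture.Theorems.NearExtremalKappaCapture.Negative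
open scoped Manifold ContDiff Topology ENNReal

/-- **The transfer stub of line `polynomial-closure`, restricted to the crux's near-extremal range, follows from
the crux with its slab-law and background hypotheses unused and `N = 0`.** If `NearExtremalKappaCapture` holds
then there is `a₁ < 1` such that for every linear regularity `(k, w)` there are `(s, δ, kc, N, γ₀)` — namely the
crux's own `(s, δ, k)`, `N = 0`, `γ₀ = max γ p` — such that for every `M > 0` there are `(R, n, c₀ > 0, C₀ ≥ 0)`
with: for every spin `a₁M ≤ |a| < M`, all `Λ, B ≥ 1`, ANY slab-law hypothesis on the box and ANY background
bound, capture at `(M, a)` holds with basin `c₀ χ^{γ₀} ((ΛB)^N)⁻¹` and modulus `C₀ χ^{−γ₀} (ΛB)^N`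
(verbatim the conclusion of `stub_polynomialClosingBox`). Proof: `captureWith_mono` to the diagonal exponent
`γ₀ = max γ p`, then `(ΛB)^0 = 1`. [folklore] -/
theorem closingBoxNearExtremal_of_near [Kerr.Facts] [Kerr.SliceFacts]
    (h : Theses.PhaseMixingCapture.NearExtremalKappaCapture) :
    ∃ a₁ : ℝ, a₁ < 1 ∧ ∀ (k : ℕ) (w : ℝ),
      ∃ (s : ℕ) (δ : ℝ) (kc : ℕ) (N : ℕ) (γ₀ : ℝ), ∀ (M : ℝ) (hM : 0 < M),
        ∃ (R : ℝ) (n : ℕ) (c₀ : ℝ), 0 < c₀ ∧ ∃ C₀ : ℝ, 0 ≤ C₀ ∧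
          ∀ a : ℝ, a₁ * M ≤ |a| → Kerr.IsSubextremal M a → ∀ Λ B : ℝ, 1 ≤ Λ → 1 ≤ B →
            (∀ M' a' : ℝ, |M' - M| + |a' - a| ≤ M * (1 - (a / M) ^ 2) / 8 →
                Kerr.TeukolskySlabLawOn M' a' M' k w R Λ) →
            (∀ x : E4, x 0 = 0 → M ≤ Kerr.radius a x → Kerr.radius a x ≤ R → ∀ j : ℕ, j ≤ n →
              ‖iteratedFDeriv ℝ j (fun q : ℝ × E4 ↦ Kerr.scalarH M q.1 q.2) (a, x)‖ ≤ B ∧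
                ∀ μ : Fin 4,
                  ‖iteratedFDeriv ℝ j (fun q : ℝ × E4 ↦ Kerr.nullCovectorFun q.1 q.2 μ) (a, x)‖ ≤
                    B) →
            ∀ (D : InitialDataSet 𝓘(ℝ, E3) (Kerr.slice a M)) [D.metric.HasLeviCivita],
              D.IsVacuumConstraintSolution →
                InitialDataSet.dataWeightedSobolevEDist s δ D (Kerr.data M a M hM.le) <
                    ENNReal.ofReal (c₀ * (1 - (a / M) ^ 2) ^ γ₀ * ((Λ * B) ^ N)⁻¹) →
                  ∀ 𝒟 : VacuumCauchyDevelopment D, 𝒟.IsMaximal →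
                    ∃ (M' a' : ℝ) (𝒟oc : Set 𝒟.carrier), Kerr.IsSubextremal M' a' ∧
                      FarComplete 𝒟 ∧ 𝒟.toSpacetime.ConvergesToKerr 𝒟oc M' a' kc ∧
                        |M' - M| + |a' - a| ≤
                          C₀ * (1 - (a / M) ^ 2) ^ (-γ₀) * (Λ * B) ^ N *
                            √(InitialDataSet.dataWeightedSobolevEDist s δ D
                                (Kerr.data M a M hM.le)).toReal := by
  obtain ⟨s, δ, k, γ, p, a₁, ha₁, hcap⟩ := near_iff.mp h
  -- pass to the diagonal exponent `γ₀ = max γ p` (admissible exponents form an up-set)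
  have hcap' : CaptureWith s δ k (max γ p) (max γ p) a₁ :=
    captureWith_mono hcap le_rfl le_rfl le_rfl (le_max_left γ p) (le_max_right γ p) le_rfl
  refine ⟨a₁, ha₁, fun _ _ ↦ ⟨s, δ, k, 0, max γ p, fun M hM ↦ ?_⟩⟩
  obtain ⟨c, hc, C, hC⟩ := hcap' M hM
  refine ⟨0, 0, c, hc, max C 0, le_max_right C 0, ?_⟩
  intro a ha hsub Λ B _ _ _ _ D _ hvac hdist 𝒟 hmax
  have hdist' : InitialDataSet.dataWeightedSobolevEDist s δ D (Kerr.data M a M hM.le) <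
      ENNReal.ofReal (c * (1 - (a / M) ^ 2) ^ (max γ p)) := by
    simpa only [pow_zero, inv_one, mul_one] using hdist
  obtain ⟨M', a', 𝒟oc, hsub', hfar, hconv, hmod⟩ := hC a ha hsub D hvac hdist' 𝒟 hmax
  refine ⟨M', a', 𝒟oc, hsub', hfar, hconv, hmod.trans ?_⟩
  have hx0 : 0 < 1 - (a / M) ^ 2 := (kappaSq_pos_le_one hsub).1
  have hpow0 : 0 ≤ (1 - (a / M) ^ 2) ^ (-max γ p) := Real.rpow_nonneg hx0.le _
  rw [pow_zero, mul_one]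
  exact mul_le_mul_of_nonneg_right (mul_le_mul_of_nonneg_right (le_max_left C 0) hpow0)
    (Real.sqrt_nonneg _)

end Summit.FinalStateConjecture.FinalStateConjecture.Theorems.NearExtremalKappaCapture.PolynomialClosure

end
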